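import Summits.PneNP.PneNP.Theorems.SymmetryBudgetNoHiddenOrderProgramModsA
import Summits.PneNP.PneNP.Theorems.SymmetryBudgetNoHiddenOrderDecodeDefs

/-!
# `NoHiddenOrder` (stmt-PneNP-14781), (R2c) VI: the window canoniser program — module records, the walk

Route `PneNP/SymmetryBudget`; continues `SymmetryBudgetNoHiddenOrderProgramModsA.lean`.  The `DAnalysis` record of an embedded analysis shape
(`oRec`, `swRec`, `reachRec`, `mcRec`, `anRec`) and the `Decode` record `dcRec L` of the walk of a label `L` over the program `prog m` (all
equations by `rfl`).  Definitions only; supports stmt-PneNP-14781.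
-/

set_option linter.dupNamespace false -- `Summit.PneNP.PneNP.…` (D-0017 single-conjunct layout)

namespace Summit.PneNP.PneNP.Theorems

open Finset CGBits BranchSum Literature.Computability.Complexity Literature.Computability.Complexity.SymProg

namespace WCanon.R2c

variable {m : ℕ}

section anRec

variable (L : FLab m) (ι : AnIn m) (e : AnGate m → Gt m) (he : Function.Injective e)
  (hk : ∀ g, (prog m).kind (e g) = anKind L g) (hs : ∀ g, (prog m).srcs (e g) = anSrcs L ι e g)

/-- The `ValOrd` record of an embedded analysis shape. [folklore] -/
noncomputable def oRec : ValOrd (prog m) (WV m) (wn m) where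
  val := ι.val
  pr u v c c' := e (.oPr u v c c')
  lt u v := e (.oLt u v)
  eq u v := e (.oEq u v)
  kind_pr _ _ _ _ := hk _
  srcs_pr _ _ _ _ := hs _
  kind_lt _ _ := hk _
  srcs_lt _ _ := hs _
  kind_eq _ _ := hk _
  srcs_eq _ _ := hs _

include he in
/-- The `Switching` record of an embedded analysis shape. [folklore] -/
noncomputable def swRec : (prog m).Switching (WV m) (pN m) where
  mem := ι.mem
  adj := ι.adj
  eq a u := Sum.inr (e (.oEq a u))
  pr u v a b := e (.swPr u v a b)
  apr u v a b := e (.swApr u v a b)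
  twice u v :=
    ctRec (univ.image fun ab : WV m × WV m => Sum.inr (e (.swPr u v ab.1 ab.2)))
      (univ.image fun ab : WV m × WV m => Sum.inr (e (.swApr u v ab.1 ab.2))) (fun g => e (.swTw u v g)) (fun _ => hk _) (fun _ => hs _)
  nadj u v := e (.swNadj u v)
  ntw u v := e (.swNtw u v)
  kept u v := e (.swKept u v)
  added u v := e (.swAdded u v)
  sw' u v := e (.swSw' u v)
  sw u v := e (.swSw u v)
  pr_injective u v ab ab' h := by have := he h; simp only [AnGate.swPr.injEq, true_and] at this; exact Prod.ext this.1 this.2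
  apr_injective u v ab ab' h := by have := he h; simp only [AnGate.swApr.injEq, true_and] at this; exact Prod.ext this.1 this.2
  kind_pr _ _ _ _ := hk _
  srcs_pr _ _ _ _ := hs _
  kind_apr _ _ _ _ := hk _
  srcs_apr _ _ _ _ := hs _
  twice_A _ _ := rfl
  twice_B _ _ := rfl
  kind_nadj _ _ := hk _
  srcs_nadj _ _ := hs _
  kind_ntw _ _ := hk _
  srcs_ntw _ _ := hs _
  kind_kept _ _ := hk _
  srcs_kept _ _ := hs _
  kind_added _ _ := hk _
  srcs_added _ _ := hs _
  kind_sw' _ _ := hk _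
  srcs_sw' _ _ := hs _
  kind_sw _ _ := hk _
  srcs_sw _ _ := hs _

/-- The `Reach` record of an embedded analysis shape. [folklore] -/
noncomputable def reachRec : (prog m).Reach (WV m) (wn m) where
  mem := ι.mem
  edge a b := Sum.inr (e (.swSw a b))
  e u v := e (.rE u v)
  mid i u w v := e (.rMid i u w v)
  r i u v := e (.rR i u v)
  kind_e _ _ := hk _
  srcs_e _ _ := hs _
  kind_mid _ _ _ _ := hk _
  srcs_mid _ _ _ _ := hs _
  kind_r_zero _ _ := hk _
  srcs_r_zero _ _ := hs _
  kind_r_succ _ _ _ := hk _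
  srcs_r_succ _ _ _ := hs _

include he in
/-- The `MinCell` record of an embedded analysis shape. [folklore] -/
noncomputable def mcRec : (prog m).MinCell (WV m) (pN m) where
  mem := ι.mem
  eq u v := Sum.inr (e (.oEq u v))
  lt u v := Sum.inr (e (.oLt u v))
  cy u y := e (.mcCy u y)
  big u := e (.mcBig u)
  cmp v u :=
    ccRec (univ.image fun y => Sum.inr (e (.mcCy v y))) (univ.image fun y => Sum.inr (e (.mcCy u y))) (fun g => e (.mcCmp v u g))
      (fun _ => hk _) (fun _ => hs _)
  tieLT v u := e (.mcTieLT v u)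
  bo v u := e (.mcBo v u)
  better v u := e (.mcBetter v u)
  nobetter u := e (.mcNobetter u)
  sel u := e (.mcSel u)
  cy_injective u y y' h := by simpa using he h
  kind_cy _ _ := hk _
  srcs_cy _ _ := hs _
  kind_big _ := hk _
  srcs_big _ := hs _
  cmp_A _ _ := rfl
  cmp_B _ _ := rfl
  kind_tieLT _ _ := hk _
  srcs_tieLT _ _ := hs _
  kind_bo _ _ := hk _
  srcs_bo _ _ := hs _
  kind_better _ _ := hk _
  srcs_better _ _ := hs _
  kind_nobetter _ := hk _
  srcs_nobetter _ := hs _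
  kind_sel _ := hk _
  srcs_sel _ := hs _

include he in
/-- **The `DAnalysis` record of an embedded analysis shape** (membership wires injective). [folklore] -/
noncomputable def anRec (hmem : Function.Injective ι.mem) :
    DAnalysis (prog m) (WV m) (pN m) (wn m) (wn m) (lU L) (lX L) (lLam L) where
  mem := ι.mem
  val := ι.val
  cons := ι.cons
  dead := ι.dead
  adj := ι.adj
  O := oRec L ι e hk hs
  C := ⟨swRec L ι e he hk hs, reachRec L ι e hk hs, fun _ => rfl, fun _ _ => rfl⟩
  M := mcRec L ι e he hk hs
  nmem v := e (.nmem v)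
  ncons v := e (.ncons v)
  cov u w := e (.cov u w)
  all u := e (.all u)
  nall u := e (.nall u)
  disc u := e (.disc u)
  isAND := e .isAND
  nisAND := e .nisAND
  big2 := e .big2
  nbig2 := e .nbig2
  isOR := e .isOR
  stop := e .stop
  frozen := e .frozen
  nfrozen := e .nfrozen
  cand y := e (.cand y)
  ncand y := e (.ncand y)
  dom y := e (.dom y)
  ndom y := e (.ndom y)
  go := e .go
  ngo := e .ngo
  andok := e .andok
  nandok := e .nandok
  O_val := rfl
  CS_mem := rfl
  CS_adj := rfl
  CS_eq _ _ := rfl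
  M_mem := rfl
  M_eq _ _ := rfl
  M_lt _ _ := rfl
  kind_nmem _ := hk _
  srcs_nmem _ := hs _
  kind_ncons _ := hk _
  srcs_ncons _ := hs _
  kind_cov _ _ := hk _
  srcs_cov _ _ := hs _
  kind_all _ := hk _
  srcs_all _ := hs _
  kind_nall _ := hk _
  srcs_nall _ := hs _
  kind_disc _ := hk _
  srcs_disc _ := hs _
  kind_isAND := hk _
  srcs_isAND := hs _
  kind_nisAND := hk _
  srcs_nisAND := hs _
  kind_big2 := hk _
  srcs_big2 := hs _
  mem_injective := hmem
  kind_nbig2 := hk _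
  srcs_nbig2 := hs _
  kind_isOR := hk _
  srcs_isOR := hs _
  kind_stop := hk _
  srcs_stop := hs _
  kind_frozen := hk _
  srcs_frozen := hs _
  kind_nfrozen := hk _
  srcs_nfrozen := hs _
  kind_cand _ := hk _
  srcs_cand _ := hs _
  kind_ncand _ := hk _
  srcs_ncand _ := hs _
  kind_dom _ := hk _
  srcs_dom _ := hs _
  kind_ndom _ := hk _
  srcs_ndom _ := hs _
  kind_go := hk _
  srcs_go := hs _
  kind_ngo := hk _
  srcs_ngo := hs _
  kind_andok := hk _
  srcs_andok := hs _
  kind_nandok := hk _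
  srcs_nandok := hs _

end anRec

/-! ### The walk of a label -/

/-- The membership wires of a stage are injective. [folklore] -/
theorem memW_injective (L : FLab m) (k : Fin (pF m + 1)) : Function.Injective (memW L k) := by
  intro v w h
  unfold memW at h
  split_ifs at h <;> simpa using h

/-- The analysis record of stage `k` of the walk of `L`. [folklore] -/
noncomputable def anSt (L : FLab m) (k : Fin (pF m + 1)) : DAnalysis (prog m) (WV m) (pN m) (wn m) (wn m) (lU L) (lX L) (lLam L) :=
  anRec L (stIn L k) (.an L k) (fun _ _ h => (Gt.an.inj h).2.2) (fun _ => rfl) (fun _ => rfl) (memW_injective L k)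

/-- The refinement record of transition `k` of the walk of `L`. [folklore] -/
noncomputable def rvSt (L : FLab m) (k : Fin (pF m)) : RefVal (prog m) (WV m) (pN m) (wn m) (wn m) :=
  rvRec (trRIIn (stIn L k.castSucc) (.tr L k)) (fun g => .tr L k (.rv g))
    (fun _ _ h => TrGate.rv.inj (Gt.tr.inj h).2.2) (fun _ => rfl) (fun _ => rfl)

/-- **The `Decode` record of the walk of label `L`.** [folklore] -/
noncomputable def dcRec (L : FLab m) : Decode (prog m) (WV m) (pN m) (wn m) (wn m) (lU L) (lX L) (lLam L) (pF m) where
  adj := adjWire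
  memS := memW L
  valS := valW L
  consS := consW L
  deadS := deadW L
  An := anSt L
  tieD k u v := .tr L k (.tieD u v)
  ltI k u v := .tr L k (.ltI u v)
  bothD k u v := .tr L k (.bothD u v)
  noneD k u v := .tr L k (.noneD u v)
  deqv k u v := .tr L k (.deqv u v)
  eqI k u v := .tr L k (.eqI u v)
  RV := rvSt L
  takeAnd k := .tr L k .takeAnd
  ntakeAnd k := .tr L k .ntakeAnd
  takeOr k := .tr L k .takeOr
  ntakeOr k := .tr L k .ntakeOr
  newMem k w := .tr L k (.newMem w)
  m1 k v := .tr L k (.m1 v)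
  m2 k v := .tr L k (.m2 v)
  mx k v := .tr L k (.mx v)
  v1 k v c := .tr L k (.v1 v c)
  v2 k v c := .tr L k (.v2 v c)
  vx k v c := .tr L k (.vx v c)
  c1 k v := .tr L k (.c1 v)
  cx k v := .tr L k (.cx v)
  d1 k := .tr L k .d1
  d2 k := .tr L k .d2
  d3 k := .tr L k .d3
  dx k := .tr L k .dx
  An_mem _ := rfl
  An_val _ := rfl
  An_cons _ := rfl
  An_dead _ := rfl
  An_adj _ := rfl
  kind_tieD _ _ _ := rfl
  srcs_tieD _ _ _ := rfl
  kind_ltI _ _ _ := rfl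
  srcs_ltI _ _ _ := rfl
  kind_bothD _ _ _ := rfl
  srcs_bothD _ _ _ := rfl
  kind_noneD _ _ _ := rfl
  srcs_noneD _ _ _ := rfl
  kind_deqv _ _ _ := rfl
  srcs_deqv _ _ _ := rfl
  kind_eqI _ _ _ := rfl
  srcs_eqI _ _ _ := rfl
  RV_mem _ := rfl
  RV_adj _ := rfl
  RV_lt0 _ _ _ := rfl
  RV_eq0 _ _ _ := rfl
  kind_takeAnd _ := rfl
  srcs_takeAnd _ := rfl
  kind_ntakeAnd _ := rfl
  srcs_ntakeAnd _ := rfl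
  kind_takeOr _ := rfl
  srcs_takeOr _ := rfl
  kind_ntakeOr _ := rfl
  srcs_ntakeOr _ := rfl
  kind_newMem _ _ := rfl
  srcs_newMem _ _ := rfl
  kind_m1 _ _ := rfl
  srcs_m1 _ _ := rfl
  kind_m2 _ _ := rfl
  srcs_m2 _ _ := rfl
  kind_mx _ _ := rfl
  srcs_mx _ _ := rfl
  kind_v1 _ _ _ := rfl
  srcs_v1 _ _ _ := rfl
  kind_v2 _ _ _ := rfl
  srcs_v2 _ _ _ := rfl
  kind_vx _ _ _ := rfl
  srcs_vx _ _ _ := rfl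
  kind_c1 _ _ := rfl
  srcs_c1 _ _ := rfl
  kind_cx _ _ := rfl
  srcs_cx _ _ := rfl
  kind_d1 _ := rfl
  srcs_d1 _ := rfl
  kind_d2 _ := rfl
  srcs_d2 _ := rfl
  kind_d3 _ := rfl
  srcs_d3 _ := rfl
  kind_dx _ := rfl
  srcs_dx _ := rfl
  memS_succ _ _ := rfl
  valS_succ _ _ _ := rfl
  consS_succ _ _ := rfl
  deadS_succ _ := rfl

end WCanon.R2c

end Summit.PneNP.PneNP.Theorems
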